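/-
Copyright (c) 2026. All rights reserved.
Released under Apache 2.0 license as described in the file LICENSE.
-/
import Literature.AlgebraicGeometry.Resolution.WeightedCentreResidualLower
import HarnessLib

/-!
# The residual order `ν_q(h)`: the first entry of every `q`-residual invariant

Companion to `WeightedCentreResidualLower` (the set `residualInvariants q a h` of invariants of
centres living off `X_a` and admissible for `h − γ^q`, `γ` free of `X_a`, `γ(0) = 0`): the
polynomial model of the census's `C_q`-data for `F = X_a^q + h` in characteristic `p`, `q = p^n`
[cite: AbramovichTemkinWlodarczyk2024, §5.1 (p. 1575) and Thm. 5.3.1 (2) (p. 1578)].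

In characteristic `p` a `q`-th power `γ^q = Σ c_e^q X^{qe}` only has monomials all of whose
exponents are divisible by `q` (Frobenius), so a monomial `X^d` of `h` with SOME exponent not
divisible by `q` survives in every `h − γ^q` with the same coefficient.  Consequences, all in the
model and all derived here from the position-1 frame of `WeightedCentreInvariantSet`
(`b₁ ≤ ord`, [cite: AbramovichTemkinWlodarczyk2024, proof of Thm. 5.3.1 (2) (p. 1578)]):

* `exists_mem_le_of_mem_residualInvariants` (**upper half**): every `q`-residual invariant of `h`
  has an entry `≤ |d|` for every such monomial `X^d` of `h` — so its first entry is at most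
  `ν_q(h) :=` the least degree of a monomial of `h` with an exponent not divisible by `q`
  (the "residual order" of `x^q + h` after cleaning `q`-th powers,
  [cite: HauserPerlega2019, §2 (cleaning; residual order)]);
* `replicate_mem_residualInvariants` (**lower half**, any `q`): if `h − γ₀^q` has order `ν ≥ 1`
  for some admissible `γ₀` (a *cleaning* of `h` below degree `ν`), then `(ν, …, ν)` (`N − 1`
  entries: the point centre off `X_a`) is a `q`-residual invariant;
* `exists_eq_cons_of_isMaxInv_residualInvariants` (**the first-entry law**): consequently the
  maximum of the `q`-residual invariants, if attained, has FIRST ENTRY EXACTLY `ν_q(h)`;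
* `exists_cleaning` : over a perfect field of characteristic `p` the cleaning `γ₀` exists
  (`q`-th roots of the coefficients of the `q`-divisible monomials of degree `< ν_q(h)`), so the
  law is unconditional there (`exists_eq_cons_of_isMaxInv_residualInvariants_perfect`);
* `residualInvariants_y2_y3z_first_entry` : the worked instance `h = y² + y³z`, characteristic `2`:
  every maximal `2`-residual invariant starts with `4 = |y³z|` although `ord h = 2`;
* `isMaxInv_residualInvariants_oneVar` (`_perfect`) : for `h ∈ k[X_b]` in ONE variable the maximal
  `q`-residual invariant IS the singleton `(ν_q(h))` (engine 1: `C_q(h(y)) = (ν_q(h))`), e.g.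
  `isMaxInv_residualInvariants_X_pow_add_X_pow` : `max C_p(y^p + y^{p+r}) = (p + r)` for `p ∤ r`.

This is engine 1's "Lemma N" of the Resolution Observatory (FE35: `C_q(h)[0] = ν_q(h)` on all
2 130 certified rows), typed.  Value type: theorems in the polynomial weighted-centre model —
NOT a resolution theorem.
-/

namespace Literature.AlgebraicGeometry.Resolution.WeightedBlowup

open MvPolynomial

variable {k : Type*} [Field k] {N : ℕ}

/-! ## §1 Frobenius: `q`-th powers have only `q`-divisible monomials -/

/-- `γ^{p^n} = Σ_e c_e^{p^n} X^{p^n e}` in characteristic `p` (plumbing: Frobenius on `k[X]`).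
(derived here) [cite: AbramovichTemkinWlodarczyk2024, §5.1 (p. 1575)] -/
theorem pow_expChar_pow_eq_sum_monomial (p n : ℕ) [hp : Fact p.Prime] [CharP k p]
    (γ : MvPolynomial (Fin N) k) :
    γ ^ p ^ n = ∑ e ∈ γ.support, monomial (p ^ n • e) (coeff e γ ^ p ^ n) := by
  haveI : ExpChar (MvPolynomial (Fin N) k) p := ExpChar.prime hp.out
  conv_lhs => rw [γ.as_sum]
  rw [sum_pow_char_pow]
  exact Finset.sum_congr rfl fun e _ => monomial_pow

/-- A monomial with an exponent NOT divisible by `q = p^n` has coefficient `0` in every `q`-th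
power. (derived here) [cite: AbramovichTemkinWlodarczyk2024, §5.1 (p. 1575)] -/
theorem coeff_pow_expChar_pow_eq_zero (p n : ℕ) [Fact p.Prime] [CharP k p]
    (γ : MvPolynomial (Fin N) k) {d : Fin N →₀ ℕ} (hd : ∃ i, ¬ p ^ n ∣ d i) :
    coeff d (γ ^ p ^ n) = 0 := by
  classical
  rw [pow_expChar_pow_eq_sum_monomial p n γ, coeff_sum]
  refine Finset.sum_eq_zero fun e _ => ?_
  rw [coeff_monomial, if_neg]
  rintro rfl
  obtain ⟨i, hi⟩ := hd
  exact hi ⟨e i, by rw [Finsupp.smul_apply, smul_eq_mul]⟩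

/-- Such a monomial of `h` survives in `h − γ^q` with the same coefficient. (derived here)
[cite: HauserPerlega2019, §2 (cleaning; residual order)] -/
theorem coeff_sub_pow_expChar_pow (p n : ℕ) [Fact p.Prime] [CharP k p]
    (h γ : MvPolynomial (Fin N) k) {d : Fin N →₀ ℕ} (hd : ∃ i, ¬ p ^ n ∣ d i) :
    coeff d (h - γ ^ p ^ n) = coeff d h := by
  rw [coeff_sub, coeff_pow_expChar_pow_eq_zero p n γ hd, sub_zero]

/-- … in particular it is a monomial of `h − γ^q`. (derived here)
[cite: HauserPerlega2019, §2 (cleaning; residual order)] -/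
theorem mem_support_sub_pow_expChar_pow (p n : ℕ) [Fact p.Prime] [CharP k p]
    {h : MvPolynomial (Fin N) k} {d : Fin N →₀ ℕ} (hdh : d ∈ h.support) (hd : ∃ i, ¬ p ^ n ∣ d i)
    (γ : MvPolynomial (Fin N) k) : d ∈ (h - γ ^ p ^ n).support := by
  rw [mem_support_iff, coeff_sub_pow_expChar_pow p n h γ hd]
  exact mem_support_iff.mp hdh

/-- … so the order of `h − γ^q` at the origin is at most `|d|`, WHATEVER `γ` is. (derived here)
[cite: HauserPerlega2019, §2 (cleaning; residual order)] -/
theorem monomialOrd_sub_pow_expChar_pow_le (p n : ℕ) [Fact p.Prime] [CharP k p]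
    {h : MvPolynomial (Fin N) k} {d : Fin N →₀ ℕ} (hdh : d ∈ h.support) (hd : ∃ i, ¬ p ^ n ∣ d i)
    (γ : MvPolynomial (Fin N) k) :
    monomialOrd (fun _ => 1) (h - γ ^ p ^ n) ≤ (d.degree : ℕ∞) := by
  have hle := monomialOrd_le_weight (fun _ => (1 : ℕ)) (mem_support_sub_pow_expChar_pow p n hdh hd γ)
  rwa [← Finsupp.degree_eq_weight_one] at hle

/-! ## §2 The upper half: every residual invariant has an entry `≤ ν_q(h)` -/

/-- The head of a sorted list is `≤` every member (plumbing). [folklore] -/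
private theorem head_le_of_mem_sorted₁₅ {x e : ℚ} {es : List ℚ} (hs : (e :: es).Pairwise (· ≤ ·))
    (hx : x ∈ e :: es) : e ≤ x := by
  rw [List.pairwise_cons] at hs
  rcases List.mem_cons.mp hx with rfl | hx
  · exact le_rfl
  · exact hs.1 x hx

/-- **Lemma N, upper half (engine 1 FE35), typed:** in characteristic `p`, `q = p^n`, every
`q`-residual invariant `b` of `h` (relative to `X_a`) has an entry `≤ |d|` for every monomial
`X^d` of `h` with an exponent not divisible by `q`.  (The centre is admissible for `h − γ^q`, whose
order is `≤ |d|` by §1, and position 1 of the frame bounds an entry by the order.) (derived here)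
[cite: AbramovichTemkinWlodarczyk2024, proof of Thm. 5.3.1 (2) (p. 1578) ("b₁ ≤ a₁")];
[cite: HauserPerlega2019, §2 (cleaning; residual order)] -/
theorem exists_mem_le_of_mem_residualInvariants (p n : ℕ) [Fact p.Prime] [CharP k p] (a : Fin N)
    {h : MvPolynomial (Fin N) k} {d : Fin N →₀ ℕ} (hdh : d ∈ h.support) (hd : ∃ i, ¬ p ^ n ∣ d i)
    {b : List ℚ} (hb : b ∈ residualInvariants (p ^ n) a h) :
    ∃ x ∈ b, x ≤ ((d.degree : ℕ) : ℚ) := by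
  obtain ⟨γ, Ψ, w, -, -, -, -, hc, rfl⟩ := hb
  have hF0 : h - γ ^ p ^ n ≠ 0 := fun h0 => by
    have hmem := mem_support_sub_pow_expChar_pow p n hdh hd γ
    rw [h0, support_zero] at hmem
    exact Finset.notMem_empty _ hmem
  have hν : monomialOrd (fun _ => 1) (h - γ ^ p ^ n) =
      ((monomialOrd (fun _ => 1) (h - γ ^ p ^ n)).toNat : ℕ) :=
    (ENat.coe_toNat (by rw [ne_eq, monomialOrd_eq_top_iff]; exact hF0)).symm
  obtain ⟨x, hx, hxle⟩ := exists_mem_exps_le hν hc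
  refine ⟨x, hx, hxle.trans ?_⟩
  have hle := monomialOrd_sub_pow_expChar_pow_le p n hdh hd γ
  rw [hν, ENat.coe_le_coe] at hle
  exact_mod_cast hle

/-- **… so its FIRST entry is `≤ |d|`** (residual invariants are sorted and nonempty). (derived here)
[cite: AbramovichTemkinWlodarczyk2024, proof of Thm. 5.3.1 (2) (p. 1578) ("b₁ ≤ a₁")] -/
theorem exists_eq_cons_le_of_mem_residualInvariants (p n : ℕ) [Fact p.Prime] [CharP k p]
    (a : Fin N) {h : MvPolynomial (Fin N) k} {d : Fin N →₀ ℕ} (hdh : d ∈ h.support)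
    (hd : ∃ i, ¬ p ^ n ∣ d i) {b : List ℚ} (hb : b ∈ residualInvariants (p ^ n) a h) :
    ∃ e es, b = e :: es ∧ e ≤ ((d.degree : ℕ) : ℚ) := by
  obtain ⟨x, hx, hxle⟩ := exists_mem_le_of_mem_residualInvariants p n a hdh hd hb
  obtain ⟨γ, Ψ, w, -, -, -, -, -, rfl⟩ := hb
  obtain ⟨e, es, hees⟩ : ∃ e es, exps w = e :: es := by
    cases hl : exps w with
    | nil => rw [hl] at hx; simp at hx
    | cons e es => exact ⟨e, es, rfl⟩
  have hs := exps_sorted w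
  rw [hees] at hs hx
  exact ⟨e, es, hees, (head_le_of_mem_sorted₁₅ hs hx).trans hxle⟩

/-! ## §3 The lower half: the point centre off `X_a` after cleaning -/

/-- The invariant of the point centre off `X_a` (weights `1/ν` on every `X_i`, `i ≠ a`) is
`(ν, …, ν)` with `N − 1` entries (plumbing). [folklore] -/
private theorem exps_update_const_inv₁₅ (a : Fin N) {ν : ℕ} (hν0 : 0 < ν) :
    exps (Function.update (fun _ : Fin N => (ν : ℚ)⁻¹) a 0) = List.replicate (N - 1) (ν : ℚ) := by
  classical
  have hν0' : (ν : ℚ) ≠ 0 := by exact_mod_cast hν0.ne'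
  unfold exps
  have hfilter : (Finset.univ.filter fun i => Function.update (fun _ : Fin N => (ν : ℚ)⁻¹) a 0 i ≠ 0) =
      Finset.univ.erase a := by
    ext i
    by_cases hi : i = a
    · subst hi; simp
    · simp [hi, hν0']
  have hmap : ((Finset.univ.erase a).toList.map fun i =>
      (Function.update (fun _ : Fin N => (ν : ℚ)⁻¹) a 0 i)⁻¹) = List.replicate (N - 1) (ν : ℚ) := by
    rw [List.eq_replicate_iff]
    refine ⟨by rw [List.length_map, Finset.length_toList, Finset.card_erase_of_mem (Finset.mem_univ a),
      Finset.card_univ, Fintype.card_fin], fun x hx => ?_⟩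
    obtain ⟨i, hi, rfl⟩ := List.mem_map.mp hx
    have hia : i ≠ a := (Finset.mem_erase.mp (Finset.mem_toList.mp hi)).1
    rw [Function.update_of_ne hia, inv_inv]
  rw [hfilter, hmap]
  exact (List.pairwise_replicate.mpr (Or.inr le_rfl)).insertionSort_eq

/-- **Lemma N, lower half (engine 1 FE35), typed** (any `q`): if `γ₀` is free of `X_a`, vanishes at
the origin, and `h − γ₀^q` has order `ν ≥ 1` at the origin (a CLEANING of `h` below degree `ν`:
the `q`-th-power monomials of low degree removed), then the point centre off `X_a` with weights
`1/ν` is admissible for `h − γ₀^q`, so `(ν, …, ν)` (`N − 1` entries) is a `q`-residual invariant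
of `h`. (derived here) [cite: AbramovichTemkinWlodarczyk2024, Def. 2.4.1 (2) and Rem. 5.2.3
(admissibility on monomials)]; [cite: HauserPerlega2019, §2 (cleaning; residual order)] -/
theorem replicate_mem_residualInvariants (q : ℕ) (a : Fin N) {h γ₀ : MvPolynomial (Fin N) k}
    (hh : a ∉ h.vars) (hγa : a ∉ γ₀.vars) (hγ0 : constantCoeff γ₀ = 0) {ν : ℕ}
    (hν : monomialOrd (fun _ => 1) (h - γ₀ ^ q) = ν) (hν0 : 0 < ν) :
    List.replicate (N - 1) (ν : ℚ) ∈ residualInvariants q a h := by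
  classical
  have hν0' : (0 : ℚ) < ν := by exact_mod_cast hν0
  have hFa : a ∉ (h - γ₀ ^ q).vars := fun ha => by
    rcases Finset.mem_union.mp (vars_sub_subset _ ha) with ha | ha
    · exact hh ha
    · exact hγa (vars_pow _ _ ha)
  refine ⟨γ₀, AlgEquiv.refl, Function.update (fun _ => (ν : ℚ)⁻¹) a 0, hγa, hγ0, rfl,
    Function.update_self _ _ _, ⟨fun i => constantCoeff_X k i, fun i => ?_, fun d hd => ?_⟩,
    exps_update_const_inv₁₅ a hν0⟩
  · by_cases hi : i = a
    · rw [hi, Function.update_self]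
    · rw [Function.update_of_ne hi]; exact inv_nonneg.mpr hν0'.le
  · have hdeg : ν ≤ d.degree := (le_monomialOrd_one_iff _ ν).mp hν.ge d hd
    have hda : a ∉ d.support := fun had => hFa ((mem_vars_iff_mem_support a).mpr ⟨d, hd, had⟩)
    have hval : monomialValuation (Function.update (fun _ => (ν : ℚ)⁻¹) a 0) d =
        ∑ i ∈ d.support, (d i : ℚ) * (ν : ℚ)⁻¹ := by
      unfold monomialValuation Finsupp.sum
      refine Finset.sum_congr rfl fun i hi => ?_
      beta_reduce
      rw [Function.update_of_ne (fun hia : i = a => hda (hia ▸ hi))]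
    rw [hval, ← Finset.sum_mul, ← Nat.cast_sum, ← Finsupp.degree_apply, le_mul_inv_iff₀ hν0', one_mul]
    exact_mod_cast hdeg

/-! ## §4 The first-entry law -/

/-- **Lemma N (engine 1 FE35: `C_q(h)[0] = ν_q(h)`), typed:** in characteristic `p`, `q = p^n`, let
`X^d` be a monomial of `h` (free of `X_a`) with an exponent not divisible by `q`, and let `γ₀`
(free of `X_a`, `γ₀(0) = 0`) clean `h` to order exactly `|d|`: `ord (h − γ₀^q) = |d|` — so `|d|`
is the RESIDUAL ORDER `ν_q(h)`, the least degree of a non-`q`-th-power monomial.  Then the maximum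
of the `q`-residual invariants of `h`, whenever attained, has first entry exactly `|d|`: at most
`|d|` by the upper half, and a smaller first entry would lose to the point centre `(|d|, …, |d|)`
of the lower half in the truncated-lex order. (derived here)
[cite: AbramovichTemkinWlodarczyk2024, Thm. 5.3.1 (2)–(3) (p. 1578)];
[cite: HauserPerlega2019, §2 (cleaning; residual order)] -/
theorem exists_eq_cons_of_isMaxInv_residualInvariants (p n : ℕ) [Fact p.Prime] [CharP k p]
    (a : Fin N) {h γ₀ : MvPolynomial (Fin N) k} (hh : a ∉ h.vars) {d : Fin N →₀ ℕ}
    (hdh : d ∈ h.support) (hd : ∃ i, ¬ p ^ n ∣ d i) (hγa : a ∉ γ₀.vars)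
    (hγ0 : constantCoeff γ₀ = 0) (hν : monomialOrd (fun _ => 1) (h - γ₀ ^ p ^ n) = (d.degree : ℕ))
    {b : List ℚ} (hb : IsMaxInv (residualInvariants (p ^ n) a h) b) :
    ∃ es, b = ((d.degree : ℕ) : ℚ) :: es := by
  classical
  obtain ⟨e, es, rfl, hle⟩ := exists_eq_cons_le_of_mem_residualInvariants p n a hdh hd hb.1
  refine ⟨es, ?_⟩
  rcases hle.lt_or_eq with hlt | heq
  · exfalso
    -- `d ≠ 0` has a variable `i ≠ a` in its support: so `|d| ≥ 1` and `N ≥ 2`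
    obtain ⟨i, hi⟩ := hd
    have hdi : d i ≠ 0 := fun h0 => hi (h0 ▸ dvd_zero _)
    have hia : i ≠ a := fun hia => hh ((mem_vars_iff_mem_support a).mpr ⟨d, hdh, Finsupp.mem_support_iff.mpr (hia ▸ hdi)⟩)
    have hdeg0 : 0 < d.degree := by
      rw [Finsupp.degree_apply]
      exact Finset.sum_pos' (fun _ _ => Nat.zero_le _) ⟨i, Finsupp.mem_support_iff.mpr hdi, Nat.pos_of_ne_zero hdi⟩
    have h2 : 2 ≤ N := by
      have hcard := Finset.card_le_univ ({i, a} : Finset (Fin N))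
      rwa [Finset.card_pair hia, Fintype.card_fin] at hcard
    have hlow := replicate_mem_residualInvariants (p ^ n) a hh hγa hγ0 hν hdeg0
    obtain ⟨m, hm⟩ : ∃ m, N - 1 = m + 1 := ⟨N - 2, by omega⟩
    rw [hm, List.replicate_succ] at hlow
    exact hb.2 _ hlow ((ATW.TruncLex.cons_lt_cons).mpr (Or.inl hlt))
  · rw [heq]

/-! ## §5 Cleaning exists over a perfect field -/

/-- **Cleaning below the residual order** (perfect ground field of characteristic `p`, `q = p^n`):
if `h` is free of `X_a`, vanishes at the origin, and `X^d` is a monomial of `h` of least degree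
among those with an exponent not divisible by `q`, then subtracting `γ₀^q` for
`γ₀ := Σ c_e^{1/q} X^{e/q}` over the `q`-divisible monomials `c_e X^e` of `h` of degree `< |d|`
leaves a polynomial of order exactly `|d|`, all of whose monomials are monomials of `h`; `γ₀` is free of
`X_a`, involves only variables of `h`, and vanishes at the origin.
(derived here) [cite: HauserPerlega2019, §2 (cleaning:
"any p^e-th power in the expansion of F can be eliminated"; residual order)]; [cite: AbramovichTemkinWlodarczyk2024, §5.1 (p. 1575)] -/
theorem exists_cleaning (p n : ℕ) [hp : Fact p.Prime] [CharP k p] [ExpChar k p] [PerfectRing k p]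
    (a : Fin N) {h : MvPolynomial (Fin N) k} (hh : a ∉ h.vars) (h0 : constantCoeff h = 0)
    {d : Fin N →₀ ℕ} (hdh : d ∈ h.support) (hd : ∃ i, ¬ p ^ n ∣ d i)
    (hmin : ∀ e ∈ h.support, (∃ i, ¬ p ^ n ∣ e i) → d.degree ≤ e.degree) :
    ∃ γ₀ : MvPolynomial (Fin N) k, a ∉ γ₀.vars ∧ constantCoeff γ₀ = 0 ∧
      monomialOrd (fun _ => 1) (h - γ₀ ^ p ^ n) = (d.degree : ℕ) ∧
      γ₀.vars ⊆ h.vars ∧ (h - γ₀ ^ p ^ n).support ⊆ h.support := by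
  classical
  haveI : ExpChar (MvPolynomial (Fin N) k) p := ExpChar.prime hp.out
  have hq0 : 0 < p ^ n := pow_pos hp.out.pos n
  -- the `q`-divisible monomials of `h` of degree `< |d|`, their `q`-th roots
  set S := h.support.filter (fun e => (∀ i, p ^ n ∣ e i) ∧ e.degree < d.degree) with hS
  set T := h.support.filter (fun e => ¬ ((∀ i, p ^ n ∣ e i) ∧ e.degree < d.degree)) with hT
  let root : k → k := fun c => (iterateFrobeniusEquiv k p n).symm c
  have hroot : ∀ c, root c ^ p ^ n = c := fun c => by
    show ((iterateFrobeniusEquiv k p n).symm c) ^ p ^ n = c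
    rw [← iterateFrobeniusEquiv_def, RingEquiv.apply_symm_apply]
  let ediv : (Fin N →₀ ℕ) → (Fin N →₀ ℕ) := fun e => e.mapRange (· / p ^ n) (Nat.zero_div _)
  have hediv : ∀ e : Fin N →₀ ℕ, (∀ i, p ^ n ∣ e i) → p ^ n • ediv e = e := fun e he => by
    ext i
    rw [Finsupp.smul_apply, smul_eq_mul, Finsupp.mapRange_apply, Nat.mul_div_cancel' (he i)]
  let γ₀ : MvPolynomial (Fin N) k := ∑ e ∈ S, monomial (ediv e) (root (coeff e h))
  have hγq : γ₀ ^ p ^ n = ∑ e ∈ S, monomial e (coeff e h) := by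
    show (∑ e ∈ S, monomial (ediv e) (root (coeff e h))) ^ p ^ n = _
    rw [sum_pow_char_pow]
    refine Finset.sum_congr rfl fun e he => ?_
    rw [monomial_pow, hroot, hediv e (Finset.mem_filter.mp he).2.1]
  -- the cleaned polynomial is the sum of the remaining monomials of `h`
  have hR : h - γ₀ ^ p ^ n = ∑ e ∈ T, monomial e (coeff e h) := by
    rw [hγq, sub_eq_iff_eq_add, add_comm, hS, hT, Finset.sum_filter_add_sum_filter_not]
    exact h.as_sum
  have hcoeffR : ∀ e', coeff e' (h - γ₀ ^ p ^ n) = if e' ∈ T then coeff e' h else 0 := fun e' => by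
    rw [hR, coeff_sum]
    simp_rw [coeff_monomial]
    rw [Finset.sum_ite_eq']
  have hsuppR : ∀ e' ∈ (h - γ₀ ^ p ^ n).support, e' ∈ T := fun e' he' => by
    by_contra hT'
    rw [mem_support_iff, hcoeffR, if_neg hT'] at he'
    exact he' rfl
  have hdT : d ∈ T := by
    rw [hT, Finset.mem_filter]
    refine ⟨hdh, fun hc => ?_⟩
    obtain ⟨i, hi⟩ := hd
    exact hi (hc.1 i)
  have hγsupp : ∀ e' ∈ γ₀.support, ∃ e ∈ S, e' = ediv e := fun e' he' => by
    have hsub := support_sum (s := S) (f := fun e => monomial (ediv e) (root (coeff e h))) he'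
    obtain ⟨e, he, hmem⟩ := Finset.mem_biUnion.mp hsub
    exact ⟨e, he, Finset.mem_singleton.mp (support_monomial_subset hmem)⟩
  -- every variable of `γ₀` is a variable of `h` (the exponents of `γ₀` are `e/q` for monomials `e` of `h`)
  have hvars : γ₀.vars ⊆ h.vars := fun x hx => by
    obtain ⟨e', he', hxe'⟩ := (mem_vars_iff_mem_support x).mp hx
    obtain ⟨e, he, rfl⟩ := hγsupp e' he'
    have hex : e x ≠ 0 := fun h0 => by
      rw [Finsupp.mem_support_iff, Finsupp.mapRange_apply, h0, Nat.zero_div] at hxe'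
      exact hxe' rfl
    exact (mem_vars_iff_mem_support x).mpr ⟨e, (Finset.mem_filter.mp he).1, Finsupp.mem_support_iff.mpr hex⟩
  refine ⟨γ₀, fun ha => hh (hvars ha), ?_, le_antisymm ?_ ?_, hvars, fun e he => ?_⟩
  · -- `γ₀(0) = 0`: the exponent `0 = e/q` would force `e = 0`, a constant term of `h`
    have hc0 : coeff 0 h = 0 := by
      have h0' := h0
      rwa [constantCoeff_eq] at h0'
    rw [constantCoeff_eq]
    by_contra hne
    obtain ⟨e, he, h0e⟩ := hγsupp 0 (mem_support_iff.mpr hne)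
    have he0 : e = 0 := by
      rw [← hediv e (Finset.mem_filter.mp he).2.1, ← h0e, smul_zero]
    have h0mem : (0 : Fin N →₀ ℕ) ∈ h.support := he0 ▸ (Finset.mem_filter.mp he).1
    exact mem_support_iff.mp h0mem hc0
  · -- `ord ≤ |d|`: `d` survives
    have hle := monomialOrd_le_weight (fun _ => (1 : ℕ))
      (mem_support_iff.mpr (by rw [hcoeffR, if_pos hdT]; exact mem_support_iff.mp hdh) :
        d ∈ (h - γ₀ ^ p ^ n).support)
    rwa [← Finsupp.degree_eq_weight_one] at hle
  · -- `|d| ≤ ord`: every surviving monomial has degree `≥ |d|`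
    rw [le_monomialOrd_one_iff]
    intro e he
    have heT := hsuppR e he
    rw [hT, Finset.mem_filter, not_and_or, not_lt] at heT
    rcases heT.2 with hndiv | hge
    · exact hmin e heT.1 (by simpa using hndiv)
    · exact hge
  · -- the cleaned polynomial only has monomials of `h`
    have heT := hsuppR e he
    rw [hT, Finset.mem_filter] at heT
    exact heT.1

/-- **The first-entry law over a perfect field** (e.g. `𝔽_p`, any finite or algebraically closed
field of characteristic `p`): for `h` free of `X_a` with `h(0) = 0` and `X^d` a monomial of `h` of
least degree among those with an exponent not divisible by `q = p^n`, the maximum of the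
`q`-residual invariants of `h`, whenever attained, has first entry `|d| = ν_q(h)`. (derived here)
[cite: AbramovichTemkinWlodarczyk2024, Thm. 5.3.1 (2)–(3) (p. 1578)];
[cite: HauserPerlega2019, §2 (cleaning; residual order)] -/
theorem exists_eq_cons_of_isMaxInv_residualInvariants_perfect (p n : ℕ) [Fact p.Prime] [CharP k p]
    [ExpChar k p] [PerfectRing k p] (a : Fin N) {h : MvPolynomial (Fin N) k} (hh : a ∉ h.vars)
    (h0 : constantCoeff h = 0) {d : Fin N →₀ ℕ} (hdh : d ∈ h.support) (hd : ∃ i, ¬ p ^ n ∣ d i)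
    (hmin : ∀ e ∈ h.support, (∃ i, ¬ p ^ n ∣ e i) → d.degree ≤ e.degree)
    {b : List ℚ} (hb : IsMaxInv (residualInvariants (p ^ n) a h) b) :
    ∃ es, b = ((d.degree : ℕ) : ℚ) :: es := by
  obtain ⟨γ₀, hγa, hγ0, hν, -, -⟩ := exists_cleaning p n a hh h0 hdh hd hmin
  exact exists_eq_cons_of_isMaxInv_residualInvariants p n a hh hdh hd hγa hγ0 hν hb

/-! ## §6 A worked instance (characteristic `2`) -/

/-- `x` does not occur in `y² + y³z` (plumbing). [folklore] -/
private theorem zero_notMem_vars_y2_y3z₁₅ :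
    (0 : Fin 3) ∉ (X 1 ^ 2 + X 1 ^ 3 * X 2 : MvPolynomial (Fin 3) k).vars := by
  classical
  intro hmem
  rcases Finset.mem_union.mp (vars_add_subset _ _ hmem) with h1 | h2
  · have h1' := vars_pow _ _ h1
    simp [vars_X] at h1'
  · rcases Finset.mem_union.mp (vars_mul _ _ h2) with h3 | h4
    · have h3' := vars_pow _ _ h3
      simp [vars_X] at h3'
    · simp [vars_X] at h4

/-- `y³z` as a monomial (plumbing). [folklore] -/
private theorem X_pow_three_mul_X_eq_monomial₁₅ :
    (X 1 ^ 3 * X 2 : MvPolynomial (Fin 3) k) = monomial (Finsupp.single 1 3 + Finsupp.single 2 1) 1 := by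
  rw [X_pow_eq_monomial, X, monomial_mul, mul_one]

/-- **Worked instance:** `h = y² + y³z` in characteristic `2`, `q = 2`, `X_a = x`.  The least-degree
monomial of `h` that is not a square is `y³z` (degree `4`), and `γ₀ = y` cleans `h` to `y³z`, of
order exactly `4`; so EVERY maximal `2`-residual invariant of `h` has first entry `4 = ν₂(h)`
(although `ord h = 2`; the maximum `(4, 4)` is attained, `residualInvariants_instance_y2_y3z`).
(derived here) [cite: AbramovichTemkinWlodarczyk2024, Thm. 5.3.1 (2)–(3) (p. 1578)];
[cite: HauserPerlega2019, §2 (cleaning; residual order)] -/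
theorem residualInvariants_y2_y3z_first_entry [CharP k 2] {b : List ℚ}
    (hb : IsMaxInv (residualInvariants (2 ^ 1) (0 : Fin 3)
      (X 1 ^ 2 + X 1 ^ 3 * X 2 : MvPolynomial (Fin 3) k)) b) :
    ∃ es, b = 4 :: es := by
  classical
  haveI : Fact (Nat.Prime 2) := ⟨Nat.prime_two⟩
  have h21 : (2 : Fin 3) ≠ 1 := by decide
  have hd : (Finsupp.single 1 3 + Finsupp.single 2 1 : Fin 3 →₀ ℕ) ∈
      (X 1 ^ 2 + X 1 ^ 3 * X 2 : MvPolynomial (Fin 3) k).support := by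
    rw [mem_support_iff, coeff_add, X_pow_three_mul_X_eq_monomial₁₅, coeff_monomial, if_pos rfl,
      X_pow_eq_monomial, coeff_monomial, if_neg, zero_add]
    · exact one_ne_zero
    · intro h12
      have h2 := Finsupp.ext_iff.mp h12 2
      simp [h21] at h2
  have hndiv : ∃ i, ¬ 2 ^ 1 ∣ (Finsupp.single 1 3 + Finsupp.single 2 1 : Fin 3 →₀ ℕ) i :=
    ⟨2, by simp [h21]⟩
  have hν : monomialOrd (fun _ => 1) ((X 1 ^ 2 + X 1 ^ 3 * X 2 : MvPolynomial (Fin 3) k) - X 1 ^ 2 ^ 1) =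
      ((Finsupp.single 1 3 + Finsupp.single 2 1 : Fin 3 →₀ ℕ).degree : ℕ) := by
    have hsub : (X 1 ^ 2 + X 1 ^ 3 * X 2 : MvPolynomial (Fin 3) k) - X 1 ^ 2 ^ 1 = X 1 ^ 3 * X 2 := by
      ring
    rw [hsub, X_pow_three_mul_X_eq_monomial₁₅, monomialOrd_monomial _ _ one_ne_zero,
      Finsupp.degree_eq_weight_one]
  obtain ⟨es, hes⟩ := exists_eq_cons_of_isMaxInv_residualInvariants 2 1 (0 : Fin 3)
    zero_notMem_vars_y2_y3z₁₅ hd hndiv (γ₀ := X 1) (by simp [vars_X]) (constantCoeff_X k 1) hν hb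
  refine ⟨es, ?_⟩
  rw [hes, map_add, Finsupp.degree_single, Finsupp.degree_single]
  norm_num

/-! ## §7 One-variable `h`: the maximal `q`-residual invariant is the singleton `(ν_q(h))` -/

/-- A polynomial in the single variable `X_b` has exponent vectors `single b (d b)` (plumbing). [folklore] -/
private theorem eq_single_of_vars_subset₁₅ {b : Fin N} {P : MvPolynomial (Fin N) k} (hP : P.vars ⊆ {b})
    {d : Fin N →₀ ℕ} (hd : d ∈ P.support) : d = Finsupp.single b (d b) := by
  classical
  ext i
  by_cases hi : i = b
  · rw [hi, Finsupp.single_eq_same]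
  · rw [Finsupp.single_apply, if_neg (Ne.symm hi)]
    by_contra hne
    exact hi (Finset.mem_singleton.mp
      (hP ((mem_vars_iff_mem_support i).mpr ⟨d, hd, Finsupp.mem_support_iff.mpr hne⟩)))

/-- The invariant of the hypersurface centre `X_b` with weight `1/m` is `(m)` (plumbing). [folklore] -/
private theorem exps_single_inv₁₅ (b : Fin N) {m : ℕ} (hm0 : 0 < m) :
    exps (fun i : Fin N => if i = b then (m : ℚ)⁻¹ else 0) = [(m : ℚ)] := by
  classical
  have hm0' : (m : ℚ) ≠ 0 := by exact_mod_cast hm0.ne'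
  unfold exps
  have hfilter : (Finset.univ.filter fun i => (if i = b then (m : ℚ)⁻¹ else 0) ≠ 0) = {b} := by
    ext i
    by_cases hi : i = b
    · subst hi; simp [hm0']
    · simp [hi]
  rw [hfilter, Finset.toList_singleton]
  simp

/-- **One-variable residual law (engine 1 FE35 Lemma N / FE36 Thm H (c): `C_q(h(y)) = (ν_q(h))`), typed:**
in characteristic `p`, `q = p^n`, let `h` and the cleaning polynomial `γ₀` involve only the variable
`X_b ≠ X_a`, `γ₀(0) = 0`, and suppose `y^m` is a monomial of `h` with `q ∤ m` while `h − γ₀^q` has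
order exactly `m` (so `m = ν_q(h)`, the least exponent of `h` not divisible by `q`).  Then the
maximal `q`-residual invariant of `h` relative to `X_a` IS the singleton `(m)`: it is attained by
the hypersurface centre `X_b` with weight `1/m` (admissible for `h − γ₀^q ∈ k[X_b]`), and every
`q`-residual invariant starts with an entry `≤ m` (upper half), hence is `≤ (m)` in the truncated
lex order (a list with head `m` is below or equal to its prefix `(m)`). (derived here)
[cite: HauserPerlega2019, §2 (residual order of f = z^{p^e} + F after cleaning)];
[cite: AbramovichTemkinWlodarczyk2024, Thm. 5.3.1 (2)–(3) (p. 1578)] -/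
theorem isMaxInv_residualInvariants_oneVar (p n : ℕ) [Fact p.Prime] [CharP k p] {a b : Fin N}
    (hab : a ≠ b) {h γ₀ : MvPolynomial (Fin N) k} (hh : h.vars ⊆ {b}) (hγ : γ₀.vars ⊆ {b})
    (hγ0 : constantCoeff γ₀ = 0) {m : ℕ} (hm : Finsupp.single b m ∈ h.support) (hq : ¬ p ^ n ∣ m)
    (hν : monomialOrd (fun _ => 1) (h - γ₀ ^ p ^ n) = m) :
    IsMaxInv (residualInvariants (p ^ n) a h) [(m : ℚ)] := by
  classical
  have hm0 : 0 < m := Nat.pos_of_ne_zero fun h0 => hq (h0 ▸ dvd_zero _)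
  have hm0' : (0 : ℚ) < m := by exact_mod_cast hm0
  have hd : ∃ i, ¬ p ^ n ∣ (Finsupp.single b m : Fin N →₀ ℕ) i :=
    ⟨b, by rwa [Finsupp.single_eq_same]⟩
  have hFvars : (h - γ₀ ^ p ^ n).vars ⊆ {b} := fun x hx => by
    rcases Finset.mem_union.mp (vars_sub_subset _ hx) with hx | hx
    · exact hh hx
    · exact hγ (vars_pow _ _ hx)
  refine ⟨⟨γ₀, AlgEquiv.refl, fun i => if i = b then (m : ℚ)⁻¹ else 0,
    fun ha => hab (Finset.mem_singleton.mp (hγ ha)), hγ0, rfl, if_neg hab,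
    ⟨fun i => constantCoeff_X k i, fun i => ?_, fun d hdF => ?_⟩, exps_single_inv₁₅ b hm0⟩,
    fun c hc => ?_⟩
  · beta_reduce
    by_cases hi : i = b
    · rw [if_pos hi]; exact inv_nonneg.mpr hm0'.le
    · rw [if_neg hi]
  · -- admissibility of `(X_b; 1/m)` for `h − γ₀^q ∈ k[X_b]`, of order `m`
    have hdeg : m ≤ d.degree := (le_monomialOrd_one_iff _ m).mp hν.ge d hdF
    have hds := eq_single_of_vars_subset₁₅ hFvars hdF
    rw [hds, Finsupp.degree_single] at hdeg
    unfold monomialValuation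
    rw [hds, Finsupp.sum_single_index (by simp)]
    beta_reduce
    rw [if_pos rfl, ← div_eq_mul_inv, le_div_iff₀ hm0', one_mul]
    exact_mod_cast hdeg
  · -- maximality: every residual invariant has head `≤ m`
    obtain ⟨e, es, rfl, hle⟩ := exists_eq_cons_le_of_mem_residualInvariants p n a hm hd hc
    rw [Finsupp.degree_single] at hle
    rw [ATW.TruncLex.cons_lt_cons, not_or]
    exact ⟨not_lt.mpr hle, fun h2 => ATW.TruncLex.not_nil_lt _ h2.2⟩

/-- **One-variable residual law over a perfect field:** for `h ∈ k[X_b]` (`k` perfect of characteristic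
`p`, `X_b ≠ X_a`, `h(0) = 0`) and `m = ν_q(h)` the least exponent of `h` not divisible by `q = p^n`,
the maximal `q`-residual invariant of `h` relative to `X_a` is `(m)` — the cleaning exists by
`exists_cleaning` and stays inside `k[X_b]`. (derived here)
[cite: HauserPerlega2019, §2 (cleaning; residual order)];
[cite: AbramovichTemkinWlodarczyk2024, Thm. 5.3.1 (2)–(3) (p. 1578)] -/
theorem isMaxInv_residualInvariants_oneVar_perfect (p n : ℕ) [Fact p.Prime] [CharP k p] [ExpChar k p]
    [PerfectRing k p] {a b : Fin N} (hab : a ≠ b) {h : MvPolynomial (Fin N) k} (hh : h.vars ⊆ {b})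
    (h0 : constantCoeff h = 0) {m : ℕ} (hm : Finsupp.single b m ∈ h.support) (hq : ¬ p ^ n ∣ m)
    (hmin : ∀ m', Finsupp.single b m' ∈ h.support → ¬ p ^ n ∣ m' → m ≤ m') :
    IsMaxInv (residualInvariants (p ^ n) a h) [(m : ℚ)] := by
  classical
  have ha : a ∉ h.vars := fun ha => hab (Finset.mem_singleton.mp (hh ha))
  have hd : ∃ i, ¬ p ^ n ∣ (Finsupp.single b m : Fin N →₀ ℕ) i :=
    ⟨b, by rwa [Finsupp.single_eq_same]⟩
  have hmin' : ∀ e ∈ h.support, (∃ i, ¬ p ^ n ∣ e i) →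
      (Finsupp.single b m : Fin N →₀ ℕ).degree ≤ e.degree := by
    rintro e he ⟨i, hi⟩
    have hes := eq_single_of_vars_subset₁₅ hh he
    have hib : i = b := by
      by_contra hib
      rw [hes, Finsupp.single_apply, if_neg (Ne.symm hib)] at hi
      exact hi (dvd_zero _)
    have he' : Finsupp.single b (e b) ∈ h.support := by rwa [← hes]
    rw [hib] at hi
    rw [hes, Finsupp.degree_single, Finsupp.degree_single]
    exact hmin (e b) he' hi
  obtain ⟨γ₀, -, hγ0, hν, hγvars, -⟩ := exists_cleaning p n a ha h0 hm hd hmin'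
  rw [Finsupp.degree_single] at hν
  exact isMaxInv_residualInvariants_oneVar p n hab hh (hγvars.trans hh) hγ0 hm hq hν

/-- **The family `y^p + y^{p+r}`, `p ∤ r`, any prime `p` (`q = p`):** the maximal `p`-residual
invariant of `h = y^p(1 + y^r)` relative to `x` is `(p + r)` — `γ₀ = y` cleans `y^p`, leaving
`y^{p+r}`.  This is the residual datum behind the split value `(p, p + r)` of `x^p + y^p(1 + y^r)`
(engine 1 FE36 Thm G/H, `e = 1`; the kangaroo equation for `r = 1`). (derived here)
[cite: HauserPerlega2019, §2 (residual order of a purely inseparable equation)];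
[cite: Hauser2010, (kangaroo phenomenon for z^p + y^p(1 + y))] -/
theorem isMaxInv_residualInvariants_X_pow_add_X_pow (p : ℕ) [Fact p.Prime] [CharP k p] {a b : Fin N}
    (hab : a ≠ b) {r : ℕ} (hr : ¬ p ∣ r) :
    IsMaxInv (residualInvariants (p ^ 1) a (X b ^ p + X b ^ (p + r) : MvPolynomial (Fin N) k))
      [((p + r : ℕ) : ℚ)] := by
  classical
  have hvars : (X b ^ p + X b ^ (p + r) : MvPolynomial (Fin N) k).vars ⊆ {b} := by
    intro x hx
    rcases Finset.mem_union.mp (vars_add_subset _ _ hx) with hx | hx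
    · have hx' := vars_pow _ _ hx
      rwa [vars_X] at hx'
    · have hx' := vars_pow _ _ hx
      rwa [vars_X] at hx'
  refine isMaxInv_residualInvariants_oneVar p 1 hab hvars (γ₀ := X b) (by rw [vars_X])
    (constantCoeff_X k b) (m := p + r) ?_ ?_ ?_
  · have hr0 : r ≠ 0 := fun h0 => hr (h0 ▸ dvd_zero p)
    rw [mem_support_iff, coeff_add, coeff_X_pow, coeff_X_pow, if_pos rfl, if_neg, zero_add]
    · exact one_ne_zero
    · intro hpe
      have hpr : p = p + r := Finsupp.single_injective b hpe
      omega
  · rw [pow_one]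
    exact fun hdvd => hr ((Nat.dvd_add_right (dvd_refl p)).mp hdvd)
  · have hsub : (X b ^ p + X b ^ (p + r) : MvPolynomial (Fin N) k) - X b ^ p ^ 1 = X b ^ (p + r) := by
      ring
    rw [hsub, X_pow_eq_monomial, monomialOrd_monomial _ _ one_ne_zero, Finsupp.weight_single,
      smul_eq_mul, mul_one]

end Literature.AlgebraicGeometry.Resolution.WeightedBlowup
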